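import Literature.NumberTheory.PAdicHodge.DeRhamSupersingularRamifiedOfEtaHom
import Literature.NumberTheory.PAdicHodge.AinfRamifiedEtaPeriodHom
import HarnessLib

/-!
# `V_pE` is de Rham for the explicit good supersingular `𝒪_D`-models of K★'s additive cells — the ramified capstone `hR'` (proofs only)

Topic `Literature/NumberTheory/PAdicHodge`; namespace `Literature.NumberTheory.PAdicHodge`. THEOREMS ONLY (no definition, no named
fact, no instance, no `sorry`). Final assembly of the ramified road (R1) (memo
`Summits/BirchSwinnertonDyer/BirchSwinnertonDyer/Cruxes/StarredOptimalManinUnitFiveSeven/Lines/kato-lever-hDR-R1-models-descent.md` §5–§6,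
BSD route EdixhovenFibreFiveSeven, crux K★ `stmt-BirchSwinnertonDyer-22226`):

* §1 **`AinfRamTop.exists_etaPeriodHomO_not_mem_filOne`** — for `W` over `CoeffDisc D`, a bridge `ψ : 𝒪_D → 𝒪_F` compatible with
  `𝒪_D → F`, `W♭ = W ⊗_ψ 𝒪_F` with good supersingular reduction at the odd residue characteristic `p`, and a Tate-module point `τ` with
  `‖p‖ < ‖τ₁‖^p`: `∫_τ η ∉ Fil¹ B_dR⁺` (η-transversality `R_p(τ₁) ∉ p𝒪_{ℂ_F}` from `AinfTop.mulDefect_evalPt₁_not_mem_span_p`, file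
  `AinfWeierstrassEtaHasseCriterionO`, read on the `𝒪_D`-side defect `mulDefect W p` through `map_mulDefect_toF` and
  `LubinTate.evalPt₁_map_of_algebraMap_eq`; then `etaPeriodHomO_not_mem_filOne`).
* §2 **`isDeRham_restrictedRationalTateRep_of_explicitModel`** — VERBATIM the explicit-model capstone `hR'` consumed by
  `Summits/…/EdixhovenFibreFiveSevenStarredOptimalManinUnitFiveSevenSupersingularCellsExplicit` (`isDeRham_supersingularCells_of_explicitCapstone`,
  `starredOptimalManinUnitFiveSeven_of_sl2NeronValues_of_explicitCapstone`): for the Eisenstein datum `D = (X^e − p, ϖ)` of the `p`-adic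
  field `F` (`p ∈ {5, 7}`), the model `W_D = ⟨0, 0, 0, a ϱ^{r₄}, b ϱ^{r₆}⟩` over `𝒪_D` with the cell numerology
  `(p; e, r₄, r₆, t₄, t₆) ∈ {(5; 3,1,0,1,0), (5; 6,4,0,2,0), (7; 4,0,2,0,1)}`, `3r₄ = e t₄`, `2r₆ = e t₆`, `64a³p^{t₄} + 432b²p^{t₆} ∈ ℤ_pˣ`,
  and any `W₀/K₀` (`K₀ ⊆ F`) with `W₀ ×_{K₀} F = W_D ⊗_{𝒪_D} F`: `restrictedRationalTateRep W₀ F p` is de Rham for `bdRPeriodRingData hp`.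
  Proof: `isDeRham_restrictedRationalTateRep_of_explicitModel_of_etaHom` (file `DeRhamSupersingularRamifiedOfEtaHom`: matching, `∫ω`, (N1′),
  socket) with `φ₂ := ∫η = AinfRamTop.etaPeriodHomO` (`ℤ_p`-linear, `Γ_F`-equivariant: file `AinfRamifiedEtaPeriodHom`) along the bridge of
  `EisensteinRoot.exists_coeffToLTCoeff`, and §1 at the Tate-module witness of `AinfTop.exists_tatePtO_norm_p_lt_norm_pow_model`.

With this file hDR|ss-cells of K★ is a THEOREM (no named fact); K★ itself stays OPEN ⟸ {P1, hT₂} (cite-only). BSD is not proved by any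
of this; the cite-only fact `isDeRham_restrictedRationalTateRep` (general `E/ℚ`) stays cite-only.

## References
* [Fontaine1982FormesDifferentielles] J.-M. Fontaine, Invent. Math. 65 (1982), §5.
* [Colmez1992PeriodesAbeliennes] P. Colmez, Math. Ann. 292 (1992), §2.
* [FontaineAsterisque223III] J.-M. Fontaine, Astérisque 223 (1994), Exp. II §1.5, Exp. III §1.5.
* [SilvermanAEC2009] J. H. Silverman, *AEC* (2009), IV.7.5, VII.2.2, VII.5.5.
* [Serre1972] J.-P. Serre, Invent. Math. 15 (1972), §1.11.
-/

noncomputable section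

open scoped Classical
open Field ValuativeRel Polynomial

namespace Literature.NumberTheory.PAdicHodge

open Literature Literature.NumberTheory.GaloisRepresentations Literature.NumberTheory.EllipticCurves
open Literature.NumberTheory.GaloisRepresentations.IsNonarchimedeanLocalField
open Literature.NumberTheory.GaloisRepresentations.LubinTate

variable {F : Type} [Field F] [ValuativeRel F] [TopologicalSpace F] [IsNonarchimedeanLocalField F] [CharZero F]
  {p : ℕ} [Fact p.Prime] [Fact (¬ IsUnit (p : integerC F))] [IsAdicComplete (Ideal.span {(p : integerC F)}) (integerC F)]

/-! ## §1 η-transversality on `T_pŴ♭(𝒪_{ℂ_F})` -/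

/-- **`∫_τ η ∉ Fil¹ B_dR⁺` at a Tate-module point with `‖p‖ < ‖τ₁‖^p`** for `W` over `CoeffDisc D` read through a bridge `ψ : 𝒪_D → 𝒪_F`
compatible with `𝒪_D → F`, `W♭ = W ⊗_ψ 𝒪_F` with `Δ ∈ 𝒪_Fˣ` and supersingular reduction at the odd residue characteristic `p`:
`R_p(τ₁) ∉ p𝒪_{ℂ_F}` (`‖R_p(u)‖ = ‖u‖^p > ‖p‖`, `AinfTop.mulDefect_evalPt₁_not_mem_span_p` applied to the integral defect
`(mulDefect W p) ⊗_ψ 𝒪_F`, whose evaluation at `u` is that of `mulDefect W p`), hence `θ_dR(∫_τ η) ≠ 0`.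
[cite: Colmez1992PeriodesAbeliennes, §2] [cite: Serre1972, §1.11] -/
theorem AinfRamTop.exists_etaPeriodHomO_not_mem_filOne {hp : valuation F p < 1} {D : EisensteinRoot F p hp} [CharP 𝓀[F] p]
    {hθ : Function.Surjective (WittVector.fontaineTheta (integerC F) p)}
    (W : WeierstrassCurve (EisensteinRoot.CoeffDisc D)) (ψ : EisensteinRoot.CoeffDisc D →+* LTCoeff F)
    (hψ : ∀ c, algebraMap (LTCoeff F) F (ψ c) = EisensteinRoot.CoeffDisc.toF D c)
    (hp2 : p ≠ 2) (hΔ : IsUnit (W.map ψ).Δ) (hA : ((W.map ψ).map (AinfTop.redCoeff F)).hasseCoeff p = 0)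
    (hτ : ∃ τ : AinfTop.TatePtO F (W.map ψ) p, ‖(p : CompletedAlgClosure F)‖ <
      ‖((((TateModule.proj p 1 τ).val : (maxNilIdealC F).toIdeal) : CBall F) : CompletedAlgClosure F)‖ ^ p) :
    ∃ τ : AinfTop.TatePtO F (W.map ψ) p, AinfRamTop.etaPeriodHomO W ψ hθ hψ τ ∉ (BdRPlusTop.filOne F p).toIdeal := by
  obtain ⟨τ, hτp⟩ := hτ
  -- the integral defect `R_p ⊗_ψ 𝒪_F` lifts `R_p(W♭ ⊗ F)`
  have hRn : PowerSeries.map (algebraMap (LTCoeff F) F) (PowerSeries.map ψ (AinfRamTop.mulDefect (hθ := hθ) W p)) =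
      ((W.map ψ).map (algebraMap (LTCoeff F) F)).formalQuasiPeriodMulDefect p := by
    rw [AinfRamTop.map_ψ_map_algebraMap W ψ hψ, ← AinfRamTop.map_mulDefect_toF (hθ := hθ) W p, ← RingHom.comp_apply (PowerSeries.map _),
      ← PowerSeries.map_comp]
    exact congrArg (fun φ => PowerSeries.map φ (AinfRamTop.mulDefect (hθ := hθ) W p)) (RingHom.ext hψ)
  have hRn0 : PowerSeries.constantCoeff (PowerSeries.map ψ (AinfRamTop.mulDefect (hθ := hθ) W p)) = 0 := by
    rw [← PowerSeries.coeff_zero_eq_constantCoeff_apply, PowerSeries.coeff_map, PowerSeries.coeff_zero_eq_constantCoeff_apply,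
      AinfRamTop.constantCoeff_mulDefect, map_zero]
  -- transversality `R_p(τ₁) ∉ p𝒪_{ℂ_F}` in the `LTCoeff`-currency, then back to the `𝒪_D`-series
  have h := AinfTop.mulDefect_evalPt₁_not_mem_span_p (W.map ψ) hp2 hΔ hA hRn hRn0 (AinfTop.seqO (W.map ψ) τ 1) hτp
  rw [evalPt₁_map_of_algebraMap_eq ψ (AinfRamTop.algebraMap_ψ_eq ψ hψ) (maxNilIdealC F) _
    (AinfRamTop.constantCoeff_mulDefect W p)] at h
  exact ⟨τ, AinfRamTop.etaPeriodHomO_not_mem_filOne W ψ τ h⟩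

/-! ## §2 The explicit-model capstone `hR'` -/

/-- **`V_pE` is de Rham for the explicit good supersingular `𝒪_D`-models of the additive cells (the ramified capstone `hR'`).** Let
`D = (X^e − p, ϖ)` be an Eisenstein datum of the `p`-adic field `F` (`p ∈ {5, 7}`), `W_D = ⟨0, 0, 0, a ϱ^{r₄}, b ϱ^{r₆}⟩` over `𝒪_D` with
`(p; e, r₄, r₆, t₄, t₆) ∈ {(5; 3,1,0,1,0), (5; 6,4,0,2,0), (7; 4,0,2,0,1)}`, `3r₄ = e t₄`, `2r₆ = e t₆`, `64a³p^{t₄} + 432b²p^{t₆} ∈ ℤ_pˣ`,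
and `W₀/K₀` (`K₀ ⊆ F`) with `W₀ ×_{K₀} F = W_D ⊗_{𝒪_D} F`. Then `restrictedRationalTateRep W₀ F p` is de Rham for Fontaine's
`bdRPeriodRingData hp`: the two `p`-adic periods `∫ω` (`Fil¹`, nonzero by (N1′)) and `∫η` (`∉ Fil¹` by §1 at the Tate-module witness
`‖p‖ < ‖τ₁‖^p` of `AinfTop.exists_tatePtO_norm_p_lt_norm_pow_model`) over the ramified Fontaine ring `A_inf(𝒪) = 𝔸_inf(F)[ϖ]`, fed to the
admissibility criterion through the matching `T_pE(F̄) ≅ T_pŴ♭(𝒪_{ℂ_F})` (`isDeRham_restrictedRationalTateRep_of_explicitModel_of_etaHom`),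
along the bridge `𝒪_D → 𝒪_F` of `EisensteinRoot.exists_coeffToLTCoeff`. BSD / K★ are not proved by this (K★ ⟸ {P1, hT₂}).
[cite: Fontaine1982FormesDifferentielles, §5] [cite: Colmez1992PeriodesAbeliennes, §2] [cite: FontaineAsterisque223III, Exp. III Thm. 1.5.2]
[cite: SilvermanAEC2009, VII.2.2] -/
theorem isDeRham_restrictedRationalTateRep_of_explicitModel
    (hp : valuation F p < 1) [Algebra ℚ_[p] F] (D : EisensteinRoot F p hp) {e : ℕ} (hD : D.poly = Polynomial.X ^ e - Polynomial.C (p : ℤ_[p]))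
    {K₀ : Type} [Field K₀] [CharZero K₀] [Algebra K₀ F] (W₀ : WeierstrassCurve K₀) [W₀.IsElliptic]
    (a b : ℤ_[p]) (r₄ r₆ t₄ t₆ : ℕ)
    (hcell : p = 5 ∧ (e = 3 ∧ r₄ = 1 ∧ r₆ = 0 ∧ t₄ = 1 ∧ t₆ = 0 ∨ e = 6 ∧ r₄ = 4 ∧ r₆ = 0 ∧ t₄ = 2 ∧ t₆ = 0) ∨
      p = 7 ∧ e = 4 ∧ r₄ = 0 ∧ r₆ = 2 ∧ t₄ = 0 ∧ t₆ = 1)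
    (h₄ : 3 * r₄ = e * t₄) (h₆ : 2 * r₆ = e * t₆) (hu : IsUnit (64 * a ^ 3 * (p : ℤ_[p]) ^ t₄ + 432 * b ^ 2 * (p : ℤ_[p]) ^ t₆))
    (hW : W₀.baseChange F = (⟨0, 0, 0, AdjoinRoot.of D.poly a * AdjoinRoot.root D.poly ^ r₄,
      AdjoinRoot.of D.poly b * AdjoinRoot.root D.poly ^ r₆⟩ : WeierstrassCurve D.Coeff).map (EisensteinRoot.Coeff.toF D)) :
    GaloisRep.IsDeRham (bdRPeriodRingData (F := F) (p := p) hp) (restrictedRationalTateRep W₀ F p) := by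
  have hθ : Function.Surjective (WittVector.fontaineTheta (integerC F) p) := surjective_fontaineTheta_integerC hp
  -- the bridge `ψ : 𝒪_D → 𝒪_F`
  obtain ⟨ψ, hψ⟩ : ∃ ψ : EisensteinRoot.CoeffDisc D →+* LTCoeff F,
      ∀ c, algebraMap (LTCoeff F) F (ψ c) = EisensteinRoot.CoeffDisc.toF D c := by
    obtain ⟨β, hβ⟩ := EisensteinRoot.exists_coeffToLTCoeff D
    exact ⟨β.comp (EisensteinRoot.CoeffDisc.of D).symm.toRingHom, fun c => hβ _⟩
  -- numerology
  have hp57 : p = 5 ∨ p = 7 := hcell.elim (fun h => Or.inl h.1) (fun h => Or.inr h.1)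
  have hp2 : p ≠ 2 := by rcases hp57 with rfl | rfl <;> norm_num
  have hr₄ : p = 5 → 0 < r₄ := fun h5 => by
    rcases hcell with ⟨-, ⟨-, h, -⟩ | ⟨-, h, -⟩⟩ | ⟨h7, -⟩ <;> omega
  have hr₆ : p = 7 → 0 < r₆ := fun h7 => by
    rcases hcell with ⟨h5, -⟩ | ⟨-, -, -, h, -⟩ <;> omega
  -- the residue characteristic
  haveI : CharP 𝓀[F] p := by
    refine (CharP.charP_iff_prime_eq_zero Fact.out).2 ?_
    rw [← map_natCast (IsLocalRing.residue 𝒪[F]), IsLocalRing.residue_eq_zero_iff, IsLocalRing.mem_maximalIdeal,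
      mem_nonunits_iff, (Valuation.integer.integers (valuation F)).isUnit_iff_valuation_eq_one]
    rw [map_natCast]
    exact hp.ne
  -- reduction data and the Tate-module witness of `W♭ = W_D ⊗_{ψ ∘ of} 𝒪_F`
  have hΔ := AinfTop.isUnit_Δ_map_model (F := F) hD (ψ.comp (EisensteinRoot.CoeffDisc.of D).toRingHom) a b h₄ h₆ hu
  have hA := AinfTop.hasseCoeff_red_map_model_eq_zero hD (ψ.comp (EisensteinRoot.CoeffDisc.of D).toRingHom) a b hp57 hr₄ hr₆
  obtain ⟨τ, -, hτp⟩ :=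
    AinfTop.exists_tatePtO_norm_p_lt_norm_pow_model hD (ψ.comp (EisensteinRoot.CoeffDisc.of D).toRingHom) a b hp57 h₄ h₆ hu hr₄ hr₆
  -- (Nη′): `∫_τ η ∉ Fil¹`
  have hNη := AinfRamTop.exists_etaPeriodHomO_not_mem_filOne (hθ := hθ)
    (((⟨0, 0, 0, AdjoinRoot.of D.poly a * AdjoinRoot.root D.poly ^ r₄, AdjoinRoot.of D.poly b * AdjoinRoot.root D.poly ^ r₆⟩ :
      WeierstrassCurve D.Coeff).map (EisensteinRoot.CoeffDisc.of D).toRingHom)) ψ hψ hp2 hΔ hA ⟨τ, hτp⟩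
  -- assembly
  exact isDeRham_restrictedRationalTateRep_of_explicitModel_of_etaHom hp D hD W₀ a b r₄ r₆ t₄ t₆ hcell h₄ h₆ hu hW ψ hψ
    (AinfRamTop.etaPeriodHomO _ ψ hθ hψ) (AinfRamTop.etaPeriodHomO_smul' _ ψ) (AinfRamTop.gal_etaPeriodHomO _ ψ) hNη

end Literature.NumberTheory.PAdicHodge

end
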